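import Summits.ValiantsHypothesis.ValiantsHypothesis.Theses.DivisionGap

/-!
# `PerMultiplesToDivision` — the uncharged form of H1 implies the charged form

Route `route-ValiantsHypothesis-DivisionGap`, item `stmt-ValiantsHypothesis-14892` (support glue).

`PerMultiplesHard` says that for every `c`, for all large `n` and every nonzero
`h ∈ ℝ≥0[x_ij]`, `2 ^ ((log₂ n + c) ^ c) < L₊(per_n · h)`; `PerDivisionHard` asks for the same
bound against `L₊(per_n · h) + L₊(h)`.  Since `L₊(per_n · h) ≤ L₊(per_n · h) + L₊(h)` in `ℕ`,
the implication is immediate (`Nat.lt_add_right`).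
-/

-- `Summit.<Summit>.<Problem>` repeats `ValiantsHypothesis` by the tree's layout convention (D-0017).
set_option linter.dupNamespace false

namespace Summit.ValiantsHypothesis.ValiantsHypothesis.Theorems

open Summit.ValiantsHypothesis.ValiantsHypothesis.Theses.DivisionGap

/-- Glue for route `DivisionGap`: `PerMultiplesHard → PerDivisionHard`.  If every nonzero monotone
multiple `per_n · h` already needs monotone circuits of size `> 2 ^ ((log₂ n + c) ^ c)` (with `h`
not charged), then a fortiori `L₊(per_n · h) + L₊(h)` exceeds the same bound. -/
theorem perMultiplesToDivision_proof :
    Summit.ValiantsHypothesis.ValiantsHypothesis.Theses.DivisionGap.PerMultiplesToDivision := by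
  unfold PerMultiplesToDivision PerMultiplesHard PerDivisionHard
  intro hMul c
  obtain ⟨n₀, hn₀⟩ := hMul c
  refine ⟨n₀, fun n hn h hh => ?_⟩
  exact Nat.lt_add_right _ (hn₀ n hn h hh)

end Summit.ValiantsHypothesis.ValiantsHypothesis.Theorems
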